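import Literature.MathematicalPhysics.QuantumLattice.AnisotropicXYThermalInfraredBound
import HarnessLib

/-!
# The quantum XY model with direction-dependent couplings: weighted sum rules, the variational
# energy bounds `Σᵢ Kᵢ e₁^{(i)} ≥ ½S²Σᵢ Kᵢ` (ground state and `T > 0`), a priori bounds, and the
# order parameter as `2|Λ|⁻¹ĝ¹_K(0)`

Topic `MathematicalPhysics/QuantumLattice`; the model inputs (C), (D), (S), (T) of the
Kennedy–Lieb–Shastry sum-rule argument for `H_K = -Σ_xΣᵢ Kᵢ(S¹_xS¹_{x+eᵢ} + S²_xS²_{x+eᵢ})`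
([KLS1988JSP] eq. (5)), ground state and positive temperature, complementing the infrared bounds
(A) of `AnisotropicXYInfraredBound.lean` / `AnisotropicXYThermalInfraredBound.lean` and Kubo's
inequality (B) of `AnisotropicXYKuboInequality.lean`; the isotropic originals are
`xy_structureFactor_sumRule_holds`, `kls_xy_bondCorr_lower_holds`, `xyGroundCorr_abs_le_holds`,
`lroSeq_eq` (`XYOrderDischarges.lean`, `XYOrderProofs.lean`) and `xy_pairCorr_lower_thermal`,
`abs_re_gibbsState_xy_corr_le` (`XYOrderThermalBoundsProofs.lean`). One definition
(`xyAnisoThermalCorr`, the thermal two-component correlation as a family over all sides, junk `0`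
at `L = 0`); no named fact.

## Contents

* (C_K) `xyAnisoStructureFactor_dirSumRule`, `xyAnisoStructureFactor_weightedSumRule`:
  `|Λ|⁻¹Σ_q ĝ^α_K(q) cos qᵢ = e_α^{(i)}` and `|Λ|⁻¹Σ_q ĝ^α_K(q) Σᵢ Kᵢcos qᵢ = Σᵢ Kᵢ e_α^{(i)}`
  ([KLS1988JSP] eq. (8)); thermal twins `gibbsStructureFactor_weightedSumRule`.
* (D_K) `xyAniso_weightedBondCorr_lower`: `Σᵢ Kᵢ e₁^{(i)} ≥ ½S²Σᵢ Kᵢ` (`L ≥ 3`; the product state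
  with all spins along the `1`-axis has energy `-S²|Λ|Σᵢ Kᵢ`, and
  `E₀ = Re ω_K(H_K) = -2|Λ|Σᵢ Kᵢ e₁^{(i)}`), [KLS1988PRL] after eq. (8); at `T > 0`
  `xyAniso_weightedBondCorr_lower_thermal`: `Σᵢ Kᵢ e₁^{(i)}(β) ≥ ½S²Σᵢ Kᵢ - log(n+1)/(2β)`
  (energy–entropy bound, [DLS1978] Thm. 5.1 (a)).
* (T_K) `abs_xyAnisoGroundCorr_le`, `abs_gibbsSpinCorr_xyAniso_le`: `|G^α_K(x,y)| ≤ S²`.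
* the order parameter: `xyAnisoStructureFactor_zero_momentum`, `xyAniso_lroSeq_eq/_le`,
  `xyAnisoThermalCorr`, `xyAniso_thermal_lroSeq_eq/_le`.

## References

* [KLS1988PRL] T. Kennedy, E. H. Lieb, B. S. Shastry, Phys. Rev. Lett. 61 (1988) 2582–2584,
  eqs. (3), (6) and the paragraph after (8).
* [KLS1988JSP] T. Kennedy, E. H. Lieb, B. S. Shastry, J. Stat. Phys. 53 (1988) 1019–1030,
  eqs. (5)–(8), p. 1026.
* [DLS1978] F. J. Dyson, E. H. Lieb, B. Simon, J. Stat. Phys. 18 (1978) 335–383, §1, Thm. 5.1.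
-/

noncomputable section

open Filter Topology Matrix Finset
open scoped ComplexOrder
open Literature.MathematicalPhysics.QuantumLattice
  Literature.MathematicalPhysics.QuantumLattice.SpinOperators Literature.Probability.LatticeModels
  Literature.MathematicalPhysics.QuantumLattice.XYOrderProofs
  Literature.Barriers.AtomisticToContinuum.BoseGas

namespace Literature.MathematicalPhysics.QuantumLattice

variable {d : ℕ}

/-! ### (C_K) The sum rules -/

section SumRule

variable (L : ℕ) [NeZero L] (n : ℕ) (K : Fin d → ℝ)

/-- **The direction-resolved ground-state sum rule** ([KLS1988JSP] eq. (8), one direction at a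
time): `|Λ|⁻¹Σ_q ĝ^α_K(q) cos qᵢ = e_α^{(i)}` (orthogonality of the characters,
`sum_structureFactor_mul_cos`). [cite: KLS1988JSP, eq. (8)] [cite: KLS1988PRL, eq. (6)] -/
theorem xyAnisoStructureFactor_dirSumRule (α : Fin 3) (i : Fin d) :
    (∑ q : TorusSite d L, xyAnisoStructureFactor α L n K q * Real.cos (latticeMomentum L q i)) /
        (L : ℝ) ^ d = xyAnisoDirBondCorr α L n K i := by
  have hL0 : (L : ℝ) ^ d ≠ 0 := by
    have : (L : ℝ) ≠ 0 := by exact_mod_cast NeZero.ne L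
    positivity
  simp_rw [xyAnisoStructureFactor_of_neZero, xyAnisoDirBondCorr_of_neZero, div_mul_eq_mul_div,
    ← sum_div]
  rw [sum_structureFactor_mul_cos L (xyAnisoGroundCorr α L n K) (xyAnisoGroundCorr_symm L n K α) i]
  field_simp

/-- **The weighted ground-state sum rule**: `|Λ|⁻¹Σ_q ĝ^α_K(q) (Σᵢ Kᵢ cos qᵢ) = Σᵢ Kᵢ e_α^{(i)}`.
[cite: KLS1988JSP, eq. (8)] [cite: KLS1988PRL, eq. (6)] -/
theorem xyAnisoStructureFactor_weightedSumRule (α : Fin 3) :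
    (∑ q : TorusSite d L, xyAnisoStructureFactor α L n K q *
        ∑ i : Fin d, K i * Real.cos (latticeMomentum L q i)) / (L : ℝ) ^ d =
      ∑ i : Fin d, K i * xyAnisoDirBondCorr α L n K i := by
  simp_rw [mul_sum, ← xyAnisoStructureFactor_dirSumRule L n K α, mul_div_assoc', ← sum_div]
  rw [sum_comm]
  refine congrArg (· / (L : ℝ) ^ d) (sum_congr rfl fun i _ => ?_)
  rw [mul_sum]
  exact sum_congr rfl fun q _ => by ring

variable {L n K}

/-- **The weighted thermal sum rule**: `|Λ|⁻¹Σ_q ĝ^α_β(q) (Σᵢ Kᵢ cos qᵢ) = Σᵢ Kᵢ e_α^{(i)}(β)` for a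
Hermitian torus Hamiltonian. [cite: KLS1988JSP, eq. (8)] [cite: DysonLiebSimon1978, §1] -/
theorem gibbsStructureFactor_weightedSumRule (β : ℝ) {H : Op (TorusSite d L) (n + 1)}
    (hH : H.IsHermitian) (K : Fin d → ℝ) (α : Fin 3) :
    (∑ q : TorusSite d L, gibbsStructureFactor β H α q *
        ∑ i : Fin d, K i * Real.cos (latticeMomentum L q i)) / (L : ℝ) ^ d =
      ∑ i : Fin d, K i * gibbsDirBondCorr β H α i := by
  simp_rw [mul_sum, ← gibbsStructureFactor_dirSumRule β hH α, mul_div_assoc', ← sum_div]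
  rw [sum_comm]
  refine congrArg (· / (L : ℝ) ^ d) (sum_congr rfl fun i _ => ?_)
  rw [mul_sum]
  exact sum_congr rfl fun q _ => by ring

end SumRule

/-! ### (D_K) The energy of `H_K` in a linear functional, the trial state, the variational bounds -/

section Energy

variable (L : ℕ) [NeZero L] (n : ℕ)

/-- Linearity: the real part of a linear functional on `H_K = -Σ_xΣᵢKᵢ(b⁰ + b¹)`. [folklore] -/
private theorem re_map_xyAnisoTorus (hL3 : 3 ≤ L) (φ : Op (TorusSite d L) (n + 1) →ₗ[ℂ] ℂ)
    (K : Fin d → ℝ) :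
    (φ (xyAnisoTorus L n K)).re =
      -∑ x : TorusSite d L, ∑ i : Fin d, K i *
        ((φ (spinBond n 0 x (x + Pi.single i 1))).re +
          (φ (spinBond n 1 x (x + Pi.single i 1))).re) := by
  rw [xyAnisoTorus_eq_sum L n hL3, map_neg, Complex.neg_re, map_sum, Complex.re_sum]
  congr 1
  refine sum_congr rfl fun x _ => ?_
  rw [map_sum, Complex.re_sum]
  refine sum_congr rfl fun i _ => ?_
  rw [LinearMap.map_smul, smul_eq_mul, Complex.re_ofReal_mul, xyBond, map_add, Complex.add_re]

/-- `|Λ| = L^d`. [folklore] -/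
private theorem cast_card_torusSite_eq_pow : (Fintype.card (TorusSite d L) : ℝ) = (L : ℝ) ^ d := by
  rw [Fintype.card_pi, prod_const, ZMod.card, card_univ, Fintype.card_fin]
  push_cast
  ring

variable (K : Fin d → ℝ)

/-- **The ground energy of `H_K`, bond by bond**: `Re ω_K(H_K) = -2|Λ| Σᵢ Kᵢ e₁^{(i)}` (`L ≥ 3`;
by `e₂^{(i)} = e₁^{(i)}`, the `U(1)` symmetry). [cite: KLS1988JSP, eq. (5)]
[cite: KLS1988PRL, after eq. (8)] -/
theorem re_groundStateFunctional_xyAnisoTorus_self (hL3 : 3 ≤ L) :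
    ((xyAnisoTorus L n K).groundStateFunctional (xyAnisoTorus L n K)).re =
      -2 * ((L : ℝ) ^ d * ∑ i : Fin d, K i * xyAnisoDirBondCorr 0 L n K i) := by
  have hL0 : (L : ℝ) ^ d ≠ 0 := by
    have : (L : ℝ) ≠ 0 := by exact_mod_cast NeZero.ne L
    positivity
  rw [re_map_xyAnisoTorus L n hL3, sum_comm]
  simp only [re_groundStateFunctional_aniso_spinBond, xyAnisoGroundCorr_one_eq_zero L n K]
  have he : ∀ i : Fin d, ∑ x : TorusSite d L, K i *
      (xyAnisoGroundCorr 0 L n K x (x + Pi.single i 1) +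
        xyAnisoGroundCorr 0 L n K x (x + Pi.single i 1)) =
      2 * ((L : ℝ) ^ d * (K i * xyAnisoDirBondCorr 0 L n K i)) := by
    intro i
    rw [← mul_sum, xyAnisoDirBondCorr_of_neZero,
      show ∑ x : TorusSite d L, (xyAnisoGroundCorr 0 L n K x (x + Pi.single i 1) +
        xyAnisoGroundCorr 0 L n K x (x + Pi.single i 1)) =
        2 * ∑ x : TorusSite d L, xyAnisoGroundCorr 0 L n K x (x + Pi.single i 1) by
      rw [sum_add_distrib, two_mul]]
    field_simp
  simp_rw [he]
  rw [← mul_sum, ← mul_sum]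
  ring

/-- **The Gibbs energy of `H_K`, bond by bond**: `Re⟨H_K⟩_β = -2|Λ| Σᵢ Kᵢ e₁^{(i)}(β)` (`L ≥ 3`).
[cite: KLS1988JSP, eq. (5)] [cite: DysonLiebSimon1978, Thm. 5.1] -/
theorem re_gibbsState_xyAnisoTorus_self (hL3 : 3 ≤ L) (β : ℝ) :
    (gibbsState β (xyAnisoTorus L n K) (xyAnisoTorus L n K)).re =
      -2 * ((L : ℝ) ^ d * ∑ i : Fin d, K i * gibbsDirBondCorr β (xyAnisoTorus L n K) 0 i) := by
  have hL0 : (L : ℝ) ^ d ≠ 0 := by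
    have : (L : ℝ) ≠ 0 := by exact_mod_cast NeZero.ne L
    positivity
  have hHerm : (xyAnisoTorus L n K).IsHermitian := xyAnisoTorus_isHermitian L n K
  have hS : ∀ z w : TorusSite d L, gibbsSpinCorr β (xyAnisoTorus L n K) 1 z w =
      gibbsSpinCorr β (xyAnisoTorus L n K) 0 z w :=
    fun z w => by rw [gibbsSpinCorr, gibbsSpinCorr, gibbsState_aniso_corr_one_eq_zero]
  rw [re_map_xyAnisoTorus L n hL3, sum_comm]
  simp only [re_gibbsState_spinBond' β hHerm, hS]
  have he : ∀ i : Fin d, ∑ x : TorusSite d L, K i *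
      (gibbsSpinCorr β (xyAnisoTorus L n K) 0 x (x + Pi.single i 1) +
        gibbsSpinCorr β (xyAnisoTorus L n K) 0 x (x + Pi.single i 1)) =
      2 * ((L : ℝ) ^ d * (K i * gibbsDirBondCorr β (xyAnisoTorus L n K) 0 i)) := by
    intro i
    rw [← mul_sum, gibbsDirBondCorr,
      show ∑ x : TorusSite d L, (gibbsSpinCorr β (xyAnisoTorus L n K) 0 x (x + Pi.single i 1) +
        gibbsSpinCorr β (xyAnisoTorus L n K) 0 x (x + Pi.single i 1)) =
        2 * ∑ x : TorusSite d L, gibbsSpinCorr β (xyAnisoTorus L n K) 0 x (x + Pi.single i 1) by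
      rw [sum_add_distrib, two_mul]]
    field_simp
  simp_rw [he]
  rw [← mul_sum, ← mul_sum]
  ring

/-- **The trial energy**: for a unitary `V` with `V Sᶻ Vᴴ = Sˣ`, `V Sʸ Vᴴ = Sʸ`, the rotated basis
state `(⨂V)|0…0⟩` (all spins `S¹ = +S`) has energy `-S²|Λ|Σᵢ Kᵢ` in `H_K` (`L ≥ 3`):
`⟨0…0|(⨂Vᴴ) H_K (⨂Vᴴ)ᴴ|0…0⟩ = -Σ_xΣᵢ Kᵢ S²`. [cite: KLS1988PRL, after eq. (8)] -/
theorem xyAnisoTorus_trialEnergy (hL3 : 3 ≤ L) {V : Matrix (Fin (n + 1)) (Fin (n + 1)) ℂ}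
    (hV : V * Vᴴ = 1) (hV' : Vᴴ * V = 1) (hVz : V * SpinOperators.spinZ n * Vᴴ = spinX n)
    (hVy : V * spinY n * Vᴴ = spinY n) :
    (productOp (fun _ : TorusSite d L => Vᴴ) * xyAnisoTorus L n K *
        (productOp (fun _ : TorusSite d L => Vᴴ))ᴴ) (fun _ => 0) (fun _ => 0) =
      -∑ _x : TorusSite d L, ∑ i : Fin d, ((K i : ℝ) : ℂ) * ((n : ℂ) / 2) ^ 2 := by
  haveI : Fact (1 < L) := ⟨by omega⟩
  set u : TorusSite d L → Matrix (Fin (n + 1)) (Fin (n + 1)) ℂ := fun _ => Vᴴ with hu_def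
  have hu : ∀ z, u z * (u z)ᴴ = 1 := fun _ => by rw [hu_def, conjTranspose_conjTranspose, hV']
  have hu' : ∀ z, (u z)ᴴ * u z = 1 := fun _ => by rw [hu_def, conjTranspose_conjTranspose, hV]
  have hx : Vᴴ * spinX n * V = SpinOperators.spinZ n := by
    rw [← hVz, ← mul_assoc, ← mul_assoc, hV', one_mul, mul_assoc, hV', mul_one]
  have hy : Vᴴ * spinY n * V = spinY n := by
    conv_lhs => rw [← hVy]
    rw [← mul_assoc, ← mul_assoc, hV', one_mul, mul_assoc, hV', mul_one]
  have hb0 : ∀ x y : TorusSite d L,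
      productOp u * spinBond n 0 x y * (productOp u)ᴴ = spinBond n 2 x y := by
    intro x y
    rw [productOp_conj_spinBond hu hu', spinVec_zero, hu_def]
    simp only [conjTranspose_conjTranspose, hx]
    rfl
  have hb1 : ∀ x y : TorusSite d L,
      productOp u * spinBond n 1 x y * (productOp u)ᴴ = spinBond n 1 x y := by
    intro x y
    rw [productOp_conj_spinBond hu hu', spinVec_one, hu_def]
    simp only [conjTranspose_conjTranspose, hy]
    rfl
  -- conjugate the Hamiltonian pair by pair
  have h1 : productOp u * xyAnisoTorus L n K * (productOp u)ᴴ =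
      -∑ x : TorusSite d L, ∑ i : Fin d, ((K i : ℝ) : ℂ) •
        (spinBond n 2 x (x + Pi.single i 1) + spinBond n 1 x (x + Pi.single i 1)) := by
    rw [xyAnisoTorus_eq_sum L n hL3, Matrix.mul_neg, Matrix.neg_mul, Finset.mul_sum,
      Finset.sum_mul]
    congr 1
    refine sum_congr rfl fun x _ => ?_
    rw [Finset.mul_sum, Finset.sum_mul]
    refine sum_congr rfl fun i _ => ?_
    rw [Matrix.mul_smul, Matrix.smul_mul, xyBond, Matrix.mul_add, Matrix.add_mul, hb0, hb1]
  -- nearest neighbours are distinct sites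
  have hne : ∀ (x : TorusSite d L) (i : Fin d), x ≠ x + Pi.single i 1 := by
    intro x i h
    have h' := congrFun h i
    rw [Pi.add_apply, Pi.single_eq_same, left_eq_add] at h'
    exact one_ne_zero h'
  rw [h1, Matrix.neg_apply, Matrix.sum_apply]
  congr 1
  refine sum_congr rfl fun x _ => ?_
  rw [Matrix.sum_apply]
  refine sum_congr rfl fun i _ => ?_
  rw [Matrix.smul_apply, Matrix.add_apply, spinBond_apply_self (hne x i),
    spinBond_apply_self (hne x i), spinVec_two, spinVec_one, spinZ_apply_zero_zero,
    spinY_apply_zero_zero, smul_eq_mul]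
  ring

/-- The real part of the trial sum: `Re Σ_xΣᵢ Kᵢ S² = |Λ| S² Σᵢ Kᵢ`. [folklore] -/
private theorem re_trialSum :
    (∑ _x : TorusSite d L, ∑ i : Fin d, ((K i : ℝ) : ℂ) * ((n : ℂ) / 2) ^ 2).re =
      (L : ℝ) ^ d * (((n : ℝ) / 2) ^ 2 * ∑ i : Fin d, K i) := by
  simp only [Complex.re_sum, Complex.re_ofReal_mul, re_half_sq]
  rw [sum_const, card_univ, nsmul_eq_mul, cast_card_torusSite_eq_pow]
  congr 1
  rw [mul_sum]
  exact sum_congr rfl fun i _ => mul_comm _ _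

/-- **(D_K) The variational bound** `Σᵢ Kᵢ e₁^{(i)} ≥ ½S²Σᵢ Kᵢ` (`S = n/2`, `L ≥ 3`): the tracial
ground state has energy `E₀ = -2|Λ|Σᵢ Kᵢ e₁^{(i)}`, the product state with all spins along the
`1`-axis has energy `-S²|Λ|Σᵢ Kᵢ`, and `E₀ ≤ ⟨ψ, H_Kψ⟩` (`groundEnergy_le_rayleigh`).
[cite: KLS1988PRL, after eq. (8)] [cite: KLS1988JSP, p. 1026] -/
theorem xyAniso_weightedBondCorr_lower (hL3 : 3 ≤ L) :
    ((n : ℝ) / 2) ^ 2 / 2 * ∑ i : Fin d, K i ≤ ∑ i : Fin d, K i * xyAnisoDirBondCorr 0 L n K i := by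
  haveI : Nonempty (TensorIndex (TorusSite d L) (n + 1)) := ⟨fun _ => 0⟩
  have hLd : (0 : ℝ) < (L : ℝ) ^ d := by
    have : (0 : ℝ) < L := by exact_mod_cast Nat.pos_of_ne_zero (NeZero.ne L)
    positivity
  have hHerm : (xyAnisoTorus L n K).IsHermitian := xyAnisoTorus_isHermitian L n K
  -- (1) the ground energy
  have h1 : (xyAnisoTorus L n K).groundEnergy =
      -2 * ((L : ℝ) ^ d * ∑ i : Fin d, K i * xyAnisoDirBondCorr 0 L n K i) := by
    rw [← re_groundStateFunctional_xyAnisoTorus_self L n K hL3,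
      groundStateFunctional_hamiltonian hHerm, Complex.ofReal_re]
  -- (2) the trial state
  obtain ⟨V, hV, hV', hVz, -, hVy⟩ := exists_unitary_conj_spinZ_eq_spinX n
  set W : Op (TorusSite d L) (n + 1) := productOp (fun _ : TorusSite d L => Vᴴ) with hW
  have hWW : W * Wᴴ = 1 :=
    productOp_mul_conjTranspose fun _ => by rw [conjTranspose_conjTranspose, hV']
  set v : TensorIndex (TorusSite d L) (n + 1) → ℂ := Pi.single (fun _ => 0) 1 with hv
  have hstar : star v = v := by rw [hv, ← Pi.single_star, star_one]
  have hψ : star (Wᴴ *ᵥ v) ⬝ᵥ (Wᴴ *ᵥ v) = 1 := by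
    rw [star_mulVec, conjTranspose_conjTranspose, ← dotProduct_mulVec, mulVec_mulVec, hWW,
      one_mulVec, hstar, hv, single_dotProduct, Pi.single_eq_same, one_mul]
  have h2 := groundEnergy_le_rayleigh_holds hHerm (Wᴴ *ᵥ v) hψ
  rw [h1, star_mulVec, conjTranspose_conjTranspose, ← dotProduct_mulVec, mulVec_mulVec,
    mulVec_mulVec, hstar, hv, single_dotProduct, one_mul, mulVec_single_one, Matrix.col_apply, hW,
    xyAnisoTorus_trialEnergy L n K hL3 hV hV' hVz hVy, Complex.neg_re,
    re_trialSum L n K] at h2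
  -- (3) divide by `|Λ| > 0`
  have h3 : (L : ℝ) ^ d * (((n : ℝ) / 2) ^ 2 / 2 * ∑ i : Fin d, K i) ≤
      (L : ℝ) ^ d * ∑ i : Fin d, K i * xyAnisoDirBondCorr 0 L n K i := by linarith
  exact le_of_mul_le_mul_left h3 hLd

/-- **(D_K) at positive temperature**: `Σᵢ Kᵢ e₁^{(i)}(β) ≥ ½S²Σᵢ Kᵢ - log(n+1)/(2β)` (`L ≥ 3`,
`β > 0`): `-2|Λ|Σᵢ Kᵢ e₁^{(i)}(β) = Re⟨H_K⟩_β ≤ ⟨ψ,H_Kψ⟩ + log(dim)/β`, `dim = (n+1)^{|Λ|}`,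
with the product state `ψ`. [cite: KLS1988PRL, after eq. (8)] [cite: DysonLiebSimon1978, Thm. 5.1] -/
theorem xyAniso_weightedBondCorr_lower_thermal (hL3 : 3 ≤ L) {β : ℝ} (hβ : 0 < β) :
    ((n : ℝ) / 2) ^ 2 / 2 * ∑ i : Fin d, K i - Real.log ((n : ℝ) + 1) / (2 * β) ≤
      ∑ i : Fin d, K i * gibbsDirBondCorr β (xyAnisoTorus L n K) 0 i := by
  have hLd : (0 : ℝ) < (L : ℝ) ^ d := by
    have : (0 : ℝ) < L := by exact_mod_cast Nat.pos_of_ne_zero (NeZero.ne L)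
    positivity
  have hHerm : (xyAnisoTorus L n K).IsHermitian := xyAnisoTorus_isHermitian L n K
  have hlog : Real.log (Fintype.card (TensorIndex (TorusSite d L) (n + 1))) =
      (L : ℝ) ^ d * Real.log ((n : ℝ) + 1) := by
    rw [Fintype.card_pi, prod_const, card_univ, Fintype.card_fin, Nat.cast_pow, Real.log_pow,
      cast_card_torusSite_eq_pow]
    push_cast
    ring
  -- the energy bond by bond
  have hxy := re_gibbsState_xyAnisoTorus_self L n K hL3 β
  -- the trial state `ψ = (⨂V)|0…0⟩`
  obtain ⟨V, hV, hV', hVz, -, hVy⟩ := exists_unitary_conj_spinZ_eq_spinX n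
  set W : Op (TorusSite d L) (n + 1) := productOp (fun _ : TorusSite d L => Vᴴ) with hW
  have hWW : W * Wᴴ = 1 :=
    productOp_mul_conjTranspose fun _ => by rw [conjTranspose_conjTranspose, hV']
  set v : TensorIndex (TorusSite d L) (n + 1) → ℂ := Pi.single (fun _ => 0) 1 with hv
  have hstar : star v = v := by rw [hv, ← Pi.single_star, star_one]
  have hψ : star (Wᴴ *ᵥ v) ⬝ᵥ (Wᴴ *ᵥ v) = 1 := by
    rw [star_mulVec, conjTranspose_conjTranspose, ← dotProduct_mulVec, mulVec_mulVec, hWW,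
      one_mulVec, hstar, hv, single_dotProduct, Pi.single_eq_same, one_mul]
  have hray : (star (Wᴴ *ᵥ v) ⬝ᵥ xyAnisoTorus L n K *ᵥ (Wᴴ *ᵥ v)).re =
      -((L : ℝ) ^ d * (((n : ℝ) / 2) ^ 2 * ∑ i : Fin d, K i)) := by
    rw [star_mulVec, conjTranspose_conjTranspose, ← dotProduct_mulVec, mulVec_mulVec,
      mulVec_mulVec, hstar, hv, single_dotProduct, one_mul, mulVec_single_one, Matrix.col_apply,
      hW, xyAnisoTorus_trialEnergy L n K hL3 hV hV' hVz hVy, Complex.neg_re, re_trialSum L n K]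
  -- energy–entropy bound against the trial state
  have hee := Matrix.re_gibbsState_hamiltonian_le_rayleigh hHerm hβ (Wᴴ *ᵥ v) hψ
  rw [hray, hlog, hxy] at hee
  -- divide by `|Λ| > 0`
  have h3 : (L : ℝ) ^ d * (((n : ℝ) / 2) ^ 2 / 2 * ∑ i : Fin d, K i -
      Real.log ((n : ℝ) + 1) / (2 * β)) ≤
      (L : ℝ) ^ d * ∑ i : Fin d, K i * gibbsDirBondCorr β (xyAnisoTorus L n K) 0 i := by
    have : (L : ℝ) ^ d * (Real.log ((n : ℝ) + 1) / (2 * β)) =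
        (L : ℝ) ^ d * Real.log ((n : ℝ) + 1) / β / 2 := by
      field_simp
    nlinarith [this]
  exact le_of_mul_le_mul_left h3 hLd

end Energy

/-! ### (T_K) A priori bounds -/

section APriori

variable (L : ℕ) [NeZero L] (n : ℕ) (K : Fin d → ℝ)

/-- **(T_K)** `|G^α_K(x,y)| ≤ S²` in the ground state (`S²·1 ∓ S^α_xS^α_y ≥ 0`, positivity and
normalisation of the tracial ground state). [cite: KLS1988PRL, Theorem] -/
theorem abs_xyAnisoGroundCorr_le (α : Fin 3) (x y : TorusSite d L) :
    |xyAnisoGroundCorr α L n K x y| ≤ ((n : ℝ) / 2) ^ 2 := by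
  rw [xyAnisoGroundCorr_of_neZero]
  set H := xyAnisoTorus L n K with hH
  have hHerm : H.IsHermitian := xyAnisoTorus_isHermitian L n K
  have hone : H.groundStateFunctional 1 = 1 := groundStateFunctional_one hHerm
  have hup := groundStateFunctional_nonneg_of_posSemidef H
    (posSemidef_sq_smul_one_sub_siteSpin_mul' n x y α)
  rw [map_sub, LinearMap.map_smul, hone, smul_eq_mul, mul_one] at hup
  obtain ⟨hup_re, -⟩ := Complex.nonneg_iff.mp hup
  rw [Complex.sub_re, re_half_sq] at hup_re
  have hlo := groundStateFunctional_nonneg_of_posSemidef H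
    (posSemidef_sq_smul_one_add_siteSpin_mul' n x y α)
  rw [map_add, LinearMap.map_smul, hone, smul_eq_mul, mul_one] at hlo
  obtain ⟨hlo_re, -⟩ := Complex.nonneg_iff.mp hlo
  rw [Complex.add_re, re_half_sq] at hlo_re
  rw [abs_le]
  constructor <;> linarith

/-- **(T_K) at positive temperature**: `|Re⟨S^α_xS^α_y⟩_β| ≤ S²` in the Gibbs state of `H_K`.
[cite: DysonLiebSimon1978, §1] -/
theorem abs_gibbsSpinCorr_xyAniso_le (β : ℝ) (α : Fin 3) (x y : TorusSite d L) :
    |gibbsSpinCorr β (xyAnisoTorus L n K) α x y| ≤ ((n : ℝ) / 2) ^ 2 := by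
  rw [gibbsSpinCorr]
  set H := xyAnisoTorus L n K with hH
  have hHerm : H.IsHermitian := xyAnisoTorus_isHermitian L n K
  have hone : gibbsState β H 1 = 1 := gibbsState_one β H (partitionFn_pos β hHerm).ne'
  have hup := gibbsState_nonneg_of_posSemidef β hHerm
    (posSemidef_sq_smul_one_sub_siteSpin_mul' n x y α)
  rw [map_sub, LinearMap.map_smul, hone, smul_eq_mul, mul_one] at hup
  obtain ⟨hup_re, -⟩ := Complex.nonneg_iff.mp hup
  rw [Complex.sub_re, re_half_sq] at hup_re
  have hlo := gibbsState_nonneg_of_posSemidef β hHerm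
    (posSemidef_sq_smul_one_add_siteSpin_mul' n x y α)
  rw [map_add, LinearMap.map_smul, hone, smul_eq_mul, mul_one] at hlo
  obtain ⟨hlo_re, -⟩ := Complex.nonneg_iff.mp hlo
  rw [Complex.add_re, re_half_sq] at hlo_re
  rw [abs_le]
  constructor <;> linarith

end APriori

/-! ### The order parameter: `2|Λ|⁻¹ĝ¹_K(0)` -/

section OrderParameter

/-- At zero momentum the structure factor is the volume average of the two-point function,
`ĝ^α_K(0) = |Λ|⁻¹Σ_{x,y} G^α_K(x,y)`. [cite: KLS1988PRL, before eq. (7)] -/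
theorem xyAnisoStructureFactor_zero_momentum (α : Fin 3) (L : ℕ) [NeZero L] (n : ℕ)
    (K : Fin d → ℝ) :
    xyAnisoStructureFactor α L n K (0 : TorusSite d L) =
      (∑ x : TorusSite d L, ∑ y : TorusSite d L, xyAnisoGroundCorr α L n K x y) / (L : ℝ) ^ d := by
  simp [xyAnisoStructureFactor_of_neZero]

/-- **The ground-state order parameter on the torus of side `L = 2k ≥ 2`**: the LRO sequence of
the two-component correlation `G¹_K + G²_K` equals `2|Λ|⁻¹ĝ¹_K(0)` (`G² = G¹` by the `U(1)`
symmetry). [cite: KLS1988PRL, Theorem ("LRO is equivalent to `m ≠ 0`")] -/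
theorem xyAniso_lroSeq_eq (n : ℕ) (K : Fin d → ℝ) (k : ℕ) (hk : 1 ≤ k) :
    (∑ x ∈ halfOpenBox d (2 * k), ∑ y ∈ halfOpenBox d (2 * k),
        torusPullback (fun L x y => xyAnisoGroundCorr 0 L n K x y + xyAnisoGroundCorr 1 L n K x y)
          (2 * k) x y) / ((halfOpenBox d (2 * k)).card : ℝ) ^ 2 =
      2 * (xyAnisoStructureFactor 0 (2 * k) n K (0 : TorusSite d (2 * k)) /
        ((2 * k : ℕ) : ℝ) ^ d) := by
  haveI : NeZero (2 * k) := ⟨by omega⟩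
  have hL : ((2 * k : ℕ) : ℝ) ^ d ≠ 0 := by positivity
  rw [XYOrderProofs.sum_halfOpenBox_torusPullback, card_halfOpenBox,
    xyAnisoStructureFactor_zero_momentum]
  simp only [xyAnisoGroundCorr_one_eq_zero, ← two_mul, ← mul_sum]
  push_cast
  field_simp

/-- Boundedness of the ground-state LRO sequence: `|Λ|⁻²Σ_{x,y}(G¹_K + G²_K) ≤ 2S²`.
[cite: KLS1988PRL, Theorem] -/
theorem xyAniso_lroSeq_le (n : ℕ) (K : Fin d → ℝ) (k : ℕ) :
    (∑ x ∈ halfOpenBox d (2 * k), ∑ y ∈ halfOpenBox d (2 * k),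
        torusPullback (fun L x y => xyAnisoGroundCorr 0 L n K x y + xyAnisoGroundCorr 1 L n K x y)
          (2 * k) x y) / ((halfOpenBox d (2 * k)).card : ℝ) ^ 2 ≤ 2 * ((n : ℝ) / 2) ^ 2 := by
  have hc : 0 ≤ 2 * ((n : ℝ) / 2) ^ 2 := by positivity
  refine div_le_of_le_mul₀ (by positivity) hc ?_
  have hb : ∀ x y : Site d,
      torusPullback (fun L x y => xyAnisoGroundCorr 0 L n K x y + xyAnisoGroundCorr 1 L n K x y)
        (2 * k) x y ≤ 2 * ((n : ℝ) / 2) ^ 2 := by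
    intro x y
    rw [torusPullback_apply]
    rcases Nat.eq_zero_or_pos k with rfl | hk
    · simp only [mul_zero, xyAnisoGroundCorr, dif_pos, add_zero]
      positivity
    · haveI : NeZero (2 * k) := ⟨by omega⟩
      have h0 := le_of_abs_le (abs_xyAnisoGroundCorr_le (2 * k) n K 0
        (Torus.proj (2 * k) x) (Torus.proj (2 * k) y))
      have h1 := le_of_abs_le (abs_xyAnisoGroundCorr_le (2 * k) n K 1
        (Torus.proj (2 * k) x) (Torus.proj (2 * k) y))
      linarith
  calc ∑ x ∈ halfOpenBox d (2 * k), ∑ y ∈ halfOpenBox d (2 * k),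
        torusPullback (fun L x y => xyAnisoGroundCorr 0 L n K x y + xyAnisoGroundCorr 1 L n K x y)
          (2 * k) x y
      ≤ ∑ x ∈ halfOpenBox d (2 * k), ∑ y ∈ halfOpenBox d (2 * k), 2 * ((n : ℝ) / 2) ^ 2 :=
        sum_le_sum fun x _ => sum_le_sum fun y _ => hb x y
    _ = 2 * ((n : ℝ) / 2) ^ 2 * ((halfOpenBox d (2 * k)).card : ℝ) ^ 2 := by
        simp only [sum_const, nsmul_eq_mul]
        ring

/-- The thermal two-component correlation `Re⟨S¹_xS¹_y⟩_β + Re⟨S²_xS²_y⟩_β` of `H_K` at inverse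
temperature `β`, as a family over all sides (junk `0` at `L = 0`, where there is no torus).
[cite: KLS1988PRL, Theorem] [cite: DysonLiebSimon1978, §1] -/
def xyAnisoThermalCorr (β : ℝ) (K : Fin d → ℝ) (L n : ℕ) (x y : TorusSite d L) : ℝ :=
  if hL : L = 0 then 0
  else
    haveI : NeZero L := ⟨hL⟩
    gibbsSpinCorr β (xyAnisoTorus L n K) 0 x y + gibbsSpinCorr β (xyAnisoTorus L n K) 1 x y

/-- Unfolding on a genuine torus. [cite: DysonLiebSimon1978, §1] -/
theorem xyAnisoThermalCorr_of_neZero (β : ℝ) (K : Fin d → ℝ) (L : ℕ) [NeZero L] (n : ℕ)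
    (x y : TorusSite d L) :
    xyAnisoThermalCorr β K L n x y =
      gibbsSpinCorr β (xyAnisoTorus L n K) 0 x y + gibbsSpinCorr β (xyAnisoTorus L n K) 1 x y := by
  simp [xyAnisoThermalCorr, NeZero.ne L]

/-- **The thermal order parameter on the torus of side `L = 2k ≥ 2`**: the LRO sequence of
`xyAnisoThermalCorr β K` equals `2|Λ|⁻¹ĝ¹_β(0)`. [cite: KLS1988PRL, Theorem]
[cite: DysonLiebSimon1978, Thm. 5.1] -/
theorem xyAniso_thermal_lroSeq_eq (β : ℝ) (n : ℕ) (K : Fin d → ℝ) (k : ℕ) (hk : 1 ≤ k) :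
    haveI : NeZero (2 * k) := ⟨by omega⟩
    (∑ x ∈ halfOpenBox d (2 * k), ∑ y ∈ halfOpenBox d (2 * k),
        torusPullback (fun L x y => xyAnisoThermalCorr β K L n x y) (2 * k) x y) /
        ((halfOpenBox d (2 * k)).card : ℝ) ^ 2 =
      2 * (gibbsStructureFactor β (xyAnisoTorus (2 * k) n K) 0 (0 : TorusSite d (2 * k)) /
        ((2 * k : ℕ) : ℝ) ^ d) := by
  haveI : NeZero (2 * k) := ⟨by omega⟩
  have hL : ((2 * k : ℕ) : ℝ) ^ d ≠ 0 := by positivity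
  have hS : ∀ z w : TorusSite d (2 * k), gibbsSpinCorr β (xyAnisoTorus (2 * k) n K) 1 z w =
      gibbsSpinCorr β (xyAnisoTorus (2 * k) n K) 0 z w :=
    fun z w => by rw [gibbsSpinCorr, gibbsSpinCorr, gibbsState_aniso_corr_one_eq_zero]
  rw [XYOrderProofs.sum_halfOpenBox_torusPullback, card_halfOpenBox,
    gibbsStructureFactor_zero_momentum]
  simp only [xyAnisoThermalCorr_of_neZero, hS, ← two_mul, ← mul_sum]
  push_cast
  field_simp

/-- Boundedness of the thermal LRO sequence: `≤ 2S²`. [cite: DysonLiebSimon1978, §1] -/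
theorem xyAniso_thermal_lroSeq_le (β : ℝ) (n : ℕ) (K : Fin d → ℝ) (k : ℕ) :
    (∑ x ∈ halfOpenBox d (2 * k), ∑ y ∈ halfOpenBox d (2 * k),
        torusPullback (fun L x y => xyAnisoThermalCorr β K L n x y) (2 * k) x y) /
        ((halfOpenBox d (2 * k)).card : ℝ) ^ 2 ≤ 2 * ((n : ℝ) / 2) ^ 2 := by
  have hc : 0 ≤ 2 * ((n : ℝ) / 2) ^ 2 := by positivity
  refine div_le_of_le_mul₀ (by positivity) hc ?_
  have hb : ∀ x y : Site d,
      torusPullback (fun L x y => xyAnisoThermalCorr β K L n x y) (2 * k) x y ≤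
        2 * ((n : ℝ) / 2) ^ 2 := by
    intro x y
    rw [torusPullback_apply]
    rcases Nat.eq_zero_or_pos k with rfl | hk
    · simp only [mul_zero, xyAnisoThermalCorr, dif_pos]
      positivity
    · haveI : NeZero (2 * k) := ⟨by omega⟩
      rw [xyAnisoThermalCorr_of_neZero]
      have h0 := le_of_abs_le (abs_gibbsSpinCorr_xyAniso_le (2 * k) n K β 0
        (Torus.proj (2 * k) x) (Torus.proj (2 * k) y))
      have h1 := le_of_abs_le (abs_gibbsSpinCorr_xyAniso_le (2 * k) n K β 1
        (Torus.proj (2 * k) x) (Torus.proj (2 * k) y))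
      linarith
  calc ∑ x ∈ halfOpenBox d (2 * k), ∑ y ∈ halfOpenBox d (2 * k),
        torusPullback (fun L x y => xyAnisoThermalCorr β K L n x y) (2 * k) x y
      ≤ ∑ x ∈ halfOpenBox d (2 * k), ∑ y ∈ halfOpenBox d (2 * k), 2 * ((n : ℝ) / 2) ^ 2 :=
        sum_le_sum fun x _ => sum_le_sum fun y _ => hb x y
    _ = 2 * ((n : ℝ) / 2) ^ 2 * ((halfOpenBox d (2 * k)).card : ℝ) ^ 2 := by
        simp only [sum_const, nsmul_eq_mul]
        ring

end OrderParameter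

end Literature.MathematicalPhysics.QuantumLattice
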